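import Summits.ValiantsHypothesis.ValiantsHypothesis.Theorems.BarrierLeverChainCertificateSuffices

/-!
# Route BarrierLever — item `ChainCertificateSuffices` (stmt-ValiantsHypothesis-19651), PROVED

Closing file (`--workitem stmt-ValiantsHypothesis-19651`; cell valiant-natproofs, rung V4, 𝒟-side;
prover seat val-np-p1; item typed by planner p1-g10 from memo `HOME/p1/UTD-memo-g9.md` §3(p)).
The mathematics is in the three `…ChainCertificateSuffices{Cycle,Blocks,}.lean` files (chain
weight, one-cycle lemma, block lemma, outer lemma, `ChainCert.hasCert_of_chainCertificate`); this
file is the ADAPTER from the item's bookkeeping to theirs.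

**The item's certificate format.** Tables `e f : Fin h → Bool → Fin h → Bool → ℕ` on
(position, bit, position, bit); an outer assignment `π₀` pairing every common point with itself
(`u i = w j → π₀ j = i`); for every non-common column `j` a position set `S₀ j` containing the
mismatch set of the block `(u (π₀ j), w j)`; the VALUE of a position set `S` on a block `(x, y)`
is the double sum `Σ_{a, c ∈ S} ([a = max S ∧ c = min S]·e a x_a c y_c + [a < c consecutive in S]·
f a x_a c y_c)` (`pval`; for `S = {m}` this is the loop value `e m x_m m y_m`); the certificate
condition: `Σ_j pval (S₀ j) < Σ_j pval (S j)` for every other assignment `σ` pairing common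
points identically and every admissible choice `S` of position sets for `σ`.

**The adapter.** `litVal e f` is the valuation of literal pairs that is `f` on forward pairs and
`e` on all other pairs (decoded bits); `pval e f x y S` is the loop value of `litVal e f` if
`S = {m}` (`pval_singleton`) and the chain value `ChainCert.chainVal (litVal e f) x y` of the
sorted `S` if `|S| ≥ 2` (`pval_eq_chainVal`). Hence the value of every admissible position set is
in `ChainCert.chainSet (litVal e f) x y` (`pval_mem_chainSet`) and every element of that chain
set is the value of an admissible position set (`exists_pval_eq`); so the item's condition gives
the chain-cost condition of `ChainCert.hasCert_of_chainCertificate` (compare `Σ min chainSet`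
with the item's sums through `S₀` and through minimising position sets for `σ`), and the
conclusion of the item — the UT-D certificate for `(u, w)`, verbatim — follows
(`chainCertificateSuffices_item`).

WHAT THIS IS NOT: a reduction only; its supplier `ChainCertificatesExist` (stmt-19652, «∃
coordinate order γ …») is a CONJECTURE (planner census 151/151, kit j253711/j253712/j252729);
nothing on UT-D (19316) in general, TT / TNS / item 19717, crux stmt-ValiantsHypothesis-14610, or
`VP` versus `VNP`.
-/

-- layout Summits/ValiantsHypothesis/ValiantsHypothesis forces the duplicated namespace component
set_option linter.dupNamespace false

namespace Summit.ValiantsHypothesis.ValiantsHypothesis.Theorems.BarrierLever.ChainCert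

open Finset
open Summit.ValiantsHypothesis.ValiantsHypothesis.Theorems.BarrierLever.NearPrincipal
open Summit.ValiantsHypothesis.ValiantsHypothesis.Theorems.BarrierLever.Descent

variable {h : ℕ}

/-! ## 1. From position×bit tables to a valuation of literal pairs -/

/-- The valuation of literal pairs built from the item's tables: `f` on forward pairs (row
coordinate `<` column coordinate), `e` on all other pairs (backward pairs and loops; agreement
pairs are never charged by the chain weight). Bits are decoded as in the route's statements
(`castAdd ↦` «in the row point» / «not in the column point»). -/
def litVal (e f : Fin h → Bool → Fin h → Bool → ℕ) (p q : Fin (h + h)) : ℕ :=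
  if (rowDec p).1 < (colDec q).1 then f (rowDec p).1 (rowDec p).2 (colDec q).1 (colDec q).2
  else e (rowDec p).1 (rowDec p).2 (colDec q).1 (colDec q).2

/-- `litVal` on a forward literal pair. -/
theorem litVal_lit_fwd (e f : Fin h → Bool → Fin h → Bool → ℕ) (x y : Finset (Fin h))
    {a c : Fin h} (hac : a < c) :
    litVal e f (rowL x a) (colL y c) = f a (decide (a ∈ x)) c (decide (c ∈ y)) := by
  unfold litVal; rw [rowDec_rowL, colDec_colL]; dsimp only; rw [if_pos hac]

/-- `litVal` on a backward or diagonal literal pair. -/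
theorem litVal_lit_not_fwd (e f : Fin h → Bool → Fin h → Bool → ℕ) (x y : Finset (Fin h))
    {a c : Fin h} (hac : ¬ a < c) :
    litVal e f (rowL x a) (colL y c) = e a (decide (a ∈ x)) c (decide (c ∈ y)) := by
  unfold litVal; rw [rowDec_rowL, colDec_colL]; dsimp only; rw [if_neg hac]

/-! ## 2. The item's value of a position set -/

/-- The item's VALUE of a position set `S` on the block (row point `x`, column point `y`)
(double-sum form, verbatim): `e` on the pair (max S, min S), `f` on consecutive pairs of `S`. -/
def pval (e f : Fin h → Bool → Fin h → Bool → ℕ) (x y S : Finset (Fin h)) : ℕ :=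
  ∑ a ∈ S, ∑ c ∈ S,
    ((if (∀ z ∈ S, z ≤ a) ∧ (∀ z ∈ S, c ≤ z) then e a (decide (a ∈ x)) c (decide (c ∈ y)) else 0) +
      (if a < c ∧ (∀ z ∈ S, ¬ (a < z ∧ z < c)) then f a (decide (a ∈ x)) c (decide (c ∈ y))
        else 0))

/-- The value of a singleton is the loop value. -/
theorem pval_singleton (e f : Fin h → Bool → Fin h → Bool → ℕ) (x y : Finset (Fin h)) (m : Fin h) :
    pval e f x y {m} = litVal e f (rowL x m) (colL y m) := by
  unfold pval
  rw [sum_singleton, sum_singleton, litVal_lit_not_fwd e f x y (lt_irrefl m), if_pos, if_neg,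
    add_zero]
  · rintro ⟨hlt, -⟩
    exact lt_irrefl m hlt
  · exact ⟨fun z hz => (mem_singleton.mp hz).le, fun z hz => (mem_singleton.mp hz).ge⟩

/-- The value of a position set with at least two elements is the chain value (for `litVal e f`)
of the sorted set. -/
theorem pval_eq_chainVal (e f : Fin h → Bool → Fin h → Bool → ℕ) (x y S : Finset (Fin h)) (k : ℕ)
    (hk : S.card = k + 2) :
    pval e f x y S = chainVal (litVal e f) x y (fun i => ((S.orderIsoOfFin hk i : S) : Fin h)) := by
  classical
  set F := S.orderIsoOfFin hk with hF
  -- reindex both sums along `F`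
  have hre : ∀ g : Fin h → ℕ, ∑ a ∈ S, g a = ∑ i : Fin (k + 2), g ((F i : S) : Fin h) := by
    intro g
    rw [← Finset.sum_coe_sort S, ← Equiv.sum_comp F.toEquiv]
    rfl
  have hmax : ∀ i : Fin (k + 2), (∀ z ∈ S, z ≤ ((F i : S) : Fin h)) ↔ i = Fin.last (k + 1) := by
    intro i
    constructor
    · intro hz
      have h1 : ((F (Fin.last (k + 1)) : S) : Fin h) ≤ ((F i : S) : Fin h) :=
        hz _ (Subtype.coe_prop _)
      rw [Subtype.coe_le_coe, OrderIso.le_iff_le] at h1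
      exact le_antisymm (Fin.le_last i) h1
    · rintro rfl z hz
      have h1 : F (F.symm ⟨z, hz⟩) ≤ F (Fin.last (k + 1)) := F.monotone (Fin.le_last _)
      rw [OrderIso.apply_symm_apply] at h1
      exact h1
  have hmin : ∀ i : Fin (k + 2), (∀ z ∈ S, ((F i : S) : Fin h) ≤ z) ↔ i = 0 := by
    intro i
    constructor
    · intro hz
      have h1 : ((F i : S) : Fin h) ≤ ((F 0 : S) : Fin h) := hz _ (Subtype.coe_prop _)
      rw [Subtype.coe_le_coe, OrderIso.le_iff_le] at h1
      exact le_antisymm h1 (Fin.zero_le i)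
    · rintro rfl z hz
      have h1 : F 0 ≤ F (F.symm ⟨z, hz⟩) := F.monotone (Fin.zero_le _)
      rw [OrderIso.apply_symm_apply] at h1
      exact h1
  have hcons : ∀ i j : Fin (k + 2),
      (((F i : S) : Fin h) < ((F j : S) : Fin h) ∧
        ∀ z ∈ S, ¬ (((F i : S) : Fin h) < z ∧ z < ((F j : S) : Fin h))) ↔
      (j : ℕ) = i + 1 := by
    intro i j
    constructor
    · rintro ⟨hij, hz⟩
      rw [Subtype.coe_lt_coe, OrderIso.lt_iff_lt] at hij
      have hij' : (i : ℕ) < j := hij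
      by_contra hne
      have hlt : (i : ℕ) + 1 < j := by omega
      set l : Fin (k + 2) := ⟨(i : ℕ) + 1, by omega⟩ with hl
      refine hz _ (Subtype.coe_prop (F l)) ⟨?_, ?_⟩
      · rw [Subtype.coe_lt_coe, OrderIso.lt_iff_lt]
        exact Fin.lt_def.mpr (by rw [hl]; exact Nat.lt_succ_self _)
      · rw [Subtype.coe_lt_coe, OrderIso.lt_iff_lt]
        exact Fin.lt_def.mpr (by rw [hl]; exact hlt)
    · intro hj
      refine ⟨?_, fun z hz ⟨h1, h2⟩ => ?_⟩
      · rw [Subtype.coe_lt_coe, OrderIso.lt_iff_lt]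
        exact Fin.lt_def.mpr (by omega)
      · have h1' : F i < F (F.symm ⟨z, hz⟩) := by
          rw [← Subtype.coe_lt_coe, OrderIso.apply_symm_apply]; exact h1
        have h2' : F (F.symm ⟨z, hz⟩) < F j := by
          rw [← Subtype.coe_lt_coe, OrderIso.apply_symm_apply]; exact h2
        rw [OrderIso.lt_iff_lt, Fin.lt_def] at h1' h2'
        omega
  unfold pval
  rw [hre]
  simp_rw [hre, sum_add_distrib]
  -- the `e`-part: only `(last, 0)` contributes
  have hA : ∑ i : Fin (k + 2), ∑ j : Fin (k + 2),
      (if (∀ z ∈ S, z ≤ ((F i : S) : Fin h)) ∧ (∀ z ∈ S, ((F j : S) : Fin h) ≤ z) then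
        e ((F i : S) : Fin h) (decide (((F i : S) : Fin h) ∈ x)) ((F j : S) : Fin h)
          (decide (((F j : S) : Fin h) ∈ y)) else 0) =
      litVal e f (rowL x ((F (Fin.last (k + 1)) : S) : Fin h)) (colL y ((F 0 : S) : Fin h)) := by
    have hterm : ∀ i j : Fin (k + 2),
        (if (∀ z ∈ S, z ≤ ((F i : S) : Fin h)) ∧ (∀ z ∈ S, ((F j : S) : Fin h) ≤ z) then
          e ((F i : S) : Fin h) (decide (((F i : S) : Fin h) ∈ x)) ((F j : S) : Fin h)
            (decide (((F j : S) : Fin h) ∈ y)) else 0) =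
        if i = Fin.last (k + 1) ∧ j = 0 then
          e ((F i : S) : Fin h) (decide (((F i : S) : Fin h) ∈ x)) ((F j : S) : Fin h)
            (decide (((F j : S) : Fin h) ∈ y)) else 0 := by
      intro i j
      by_cases H : (∀ z ∈ S, z ≤ ((F i : S) : Fin h)) ∧ (∀ z ∈ S, ((F j : S) : Fin h) ≤ z)
      · rw [if_pos H, if_pos ⟨(hmax i).mp H.1, (hmin j).mp H.2⟩]
      · rw [if_neg H, if_neg (fun H' => H ⟨(hmax i).mpr H'.1, (hmin j).mpr H'.2⟩)]
    simp_rw [hterm]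
    rw [Finset.sum_eq_single (Fin.last (k + 1))]
    · rw [Finset.sum_eq_single (0 : Fin (k + 2))]
      · rw [if_pos ⟨rfl, rfl⟩, litVal_lit_not_fwd]
        rw [Subtype.coe_lt_coe, OrderIso.lt_iff_lt, not_lt]
        exact Fin.zero_le _
      · intro j _ hj
        rw [if_neg (fun hh => hj hh.2)]
      · intro hh; exact absurd (mem_univ _) hh
    · intro i _ hi
      exact Finset.sum_eq_zero (fun j _ => if_neg (fun hh => hi hh.1))
    · intro hh; exact absurd (mem_univ _) hh
  -- the `f`-part: consecutive pairs `(i, i+1)`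
  have hB : ∑ i : Fin (k + 2), ∑ j : Fin (k + 2),
      (if ((F i : S) : Fin h) < ((F j : S) : Fin h) ∧
          (∀ z ∈ S, ¬ (((F i : S) : Fin h) < z ∧ z < ((F j : S) : Fin h))) then
        f ((F i : S) : Fin h) (decide (((F i : S) : Fin h) ∈ x)) ((F j : S) : Fin h)
          (decide (((F j : S) : Fin h) ∈ y)) else 0) =
      ∑ i : Fin (k + 1), litVal e f (rowL x ((F i.castSucc : S) : Fin h))
        (colL y ((F i.succ : S) : Fin h)) := by
    have hterm : ∀ i j : Fin (k + 2),
        (if ((F i : S) : Fin h) < ((F j : S) : Fin h) ∧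
            (∀ z ∈ S, ¬ (((F i : S) : Fin h) < z ∧ z < ((F j : S) : Fin h))) then
          f ((F i : S) : Fin h) (decide (((F i : S) : Fin h) ∈ x)) ((F j : S) : Fin h)
            (decide (((F j : S) : Fin h) ∈ y)) else 0) =
        if (j : ℕ) = i + 1 then
          f ((F i : S) : Fin h) (decide (((F i : S) : Fin h) ∈ x)) ((F j : S) : Fin h)
            (decide (((F j : S) : Fin h) ∈ y)) else 0 := by
      intro i j
      by_cases H : ((F i : S) : Fin h) < ((F j : S) : Fin h) ∧
          ∀ z ∈ S, ¬ (((F i : S) : Fin h) < z ∧ z < ((F j : S) : Fin h))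
      · rw [if_pos H, if_pos ((hcons i j).mp H)]
      · rw [if_neg H, if_neg (fun H' => H ((hcons i j).mpr H'))]
    simp_rw [hterm]
    rw [Fin.sum_univ_castSucc]
    have hlast : ∑ j : Fin (k + 2), (if (j : ℕ) = (Fin.last (k + 1) : ℕ) + 1 then
        f ((F (Fin.last (k + 1)) : S) : Fin h) (decide (((F (Fin.last (k + 1)) : S) : Fin h) ∈ x))
          ((F j : S) : Fin h) (decide (((F j : S) : Fin h) ∈ y)) else 0) = 0 := by
      refine Finset.sum_eq_zero (fun j _ => if_neg (fun hj => ?_))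
      rw [Fin.val_last] at hj
      have := j.isLt
      omega
    rw [hlast, add_zero]
    refine Finset.sum_congr rfl (fun i _ => ?_)
    rw [Finset.sum_eq_single i.succ]
    · rw [if_pos (by rw [Fin.val_succ, Fin.val_castSucc]), litVal_lit_fwd]
      rw [Subtype.coe_lt_coe, OrderIso.lt_iff_lt]
      exact Fin.castSucc_lt_succ
    · intro j _ hj
      refine if_neg (fun hh => hj (Fin.ext ?_))
      rw [hh, Fin.val_succ, Fin.val_castSucc]
    · intro hh; exact absurd (mem_univ _) hh
  rw [hA, hB]
  rfl

/-! ## 3. Values of admissible position sets are the chain set -/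

/-- The value of an admissible position set (one containing the mismatch set) of a block with a
mismatch lies in the chain set of `litVal e f`. -/
theorem pval_mem_chainSet (e f : Fin h → Bool → Fin h → Bool → ℕ) (x y S : Finset (Fin h))
    (hxy : x ≠ y) (hS : univ.filter (fun a => ¬ (a ∈ x ↔ a ∈ y)) ⊆ S) :
    pval e f x y S ∈ chainSet (litVal e f) x y := by
  classical
  have hMS : ∀ m, (m ∈ x ↔ m ∉ y) → m ∈ S := fun m hm =>
    hS (mem_filter.mpr ⟨mem_univ m, (mismatch_iff x y m).mp hm⟩)
  obtain ⟨m₀, hm₀⟩ : ∃ m, (m ∈ x ↔ m ∉ y) := by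
    obtain ⟨m, hm⟩ := mismatch_nonempty x y hxy
    exact ⟨m, (mem_mismatch x y m).mp hm⟩
  have hpos : 0 < S.card := Finset.card_pos.mpr ⟨m₀, hMS m₀ hm₀⟩
  rcases Nat.exists_eq_add_of_le hpos with ⟨n, hn⟩
  rcases n with _ | k
  · obtain ⟨a, ha⟩ := Finset.card_eq_one.mp (by rw [hn])
    rw [ha, pval_singleton]
    refine mem_chainSet_loop _ x y (fun m => ⟨fun hm => ?_, ?_⟩)
    · have := hMS m hm
      rw [ha] at this
      exact mem_singleton.mp this
    · rintro rfl
      by_contra hma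
      have hm₀a : m₀ = m := by
        have := hMS m₀ hm₀
        rw [ha] at this
        exact mem_singleton.mp this
      exact hma (hm₀a ▸ hm₀)
  · have hk : S.card = k + 2 := by rw [hn]; ring
    rw [pval_eq_chainVal e f x y S k hk]
    refine mem_chainSet_chain _ x y _ (fun i j hij => ?_) (fun m hm => ?_)
    · rw [Subtype.coe_lt_coe, OrderIso.lt_iff_lt]
      exact hij
    · exact ⟨(S.orderIsoOfFin hk).symm ⟨m, hMS m hm⟩, by rw [OrderIso.apply_symm_apply]⟩

/-- Every element of the chain set of `litVal e f` is the value of an admissible position set. -/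
theorem exists_pval_eq (e f : Fin h → Bool → Fin h → Bool → ℕ) (x y : Finset (Fin h)) {n : ℕ}
    (hn : n ∈ chainSet (litVal e f) x y) :
    ∃ S : Finset (Fin h), univ.filter (fun a => ¬ (a ∈ x ↔ a ∈ y)) ⊆ S ∧ pval e f x y S = n := by
  classical
  rcases hn with ⟨a, hM, rfl⟩ | ⟨k, c, hc, hcov, rfl⟩
  · refine ⟨{a}, fun m hm => ?_, pval_singleton e f x y a⟩
    rw [mem_filter] at hm
    exact mem_singleton.mpr ((hM m).mp ((mismatch_iff x y m).mpr hm.2))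
  · set S : Finset (Fin h) := univ.image c with hSdef
    have hk : S.card = k + 2 := by
      rw [hSdef, card_image_of_injective _ hc.injective, card_univ, Fintype.card_fin]
    have hcs : ∀ i, c i ∈ S := fun i => by rw [hSdef]; exact mem_image_of_mem c (mem_univ i)
    have hF : (fun i => ((S.orderIsoOfFin hk i : S) : Fin h)) = c := by
      have h1 := Finset.orderEmbOfFin_unique hk hcs hc
      funext i
      rw [Finset.coe_orderIsoOfFin_apply, ← h1]
    refine ⟨S, fun m hm => ?_, ?_⟩
    · rw [mem_filter] at hm
      obtain ⟨i, hi⟩ := hcov m ((mismatch_iff x y m).mpr hm.2)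
      rw [← hi]
      exact hcs i
    · rw [pval_eq_chainVal e f x y S k hk, hF]
      rfl

/-! ## 4. The item, verbatim -/

/-- **Item stmt-ValiantsHypothesis-19651 `ChainCertificateSuffices`, signature VERBATIM.** A chain
certificate in the item's format (tables `e f` on position×bit pairs, an assignment `π₀` pairing
the common points with themselves, admissible position sets `S₀ j`, strict optimality against
every other common-point-respecting assignment with any admissible position sets) yields the UT-D
certificate of item 19316 for the layout `(u, w)`: with `litVal e f` as the valuation of literal
pairs it is a chain certificate in the sense of `ChainCert.hasCert_of_chainCertificate` (the
values of admissible position sets are exactly the chain set, `pval_mem_chainSet` /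
`exists_pval_eq`), whose conclusion `UTDSymm.HasCert u w` is the item's conclusion verbatim. -/
theorem chainCertificateSuffices_item :
    ∀ (h r : ℕ) (u w : Fin r → Finset (Fin h)), Function.Injective u → Function.Injective w →
    (∃ (e f : Fin h → Bool → Fin h → Bool → ℕ) (π₀ : Equiv.Perm (Fin r))
        (S₀ : Fin r → Finset (Fin h)),
      (∀ i j, u i = w j → π₀ j = i) ∧
      (∀ j, u (π₀ j) ≠ w j →
        (Finset.univ.filter fun a : Fin h => ¬ (a ∈ u (π₀ j) ↔ a ∈ w j)) ⊆ S₀ j) ∧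
      ∀ (σ : Equiv.Perm (Fin r)) (S : Fin r → Finset (Fin h)), σ ≠ π₀ →
        (∀ i j, u i = w j → σ j = i) →
        (∀ j, u (σ j) ≠ w j →
          (Finset.univ.filter fun a : Fin h => ¬ (a ∈ u (σ j) ↔ a ∈ w j)) ⊆ S j) →
        (∑ j ∈ Finset.univ.filter (fun j : Fin r => u (π₀ j) ≠ w j),
          ∑ x ∈ S₀ j, ∑ y ∈ S₀ j,
            ((if (∀ z ∈ S₀ j, z ≤ x) ∧ (∀ z ∈ S₀ j, y ≤ z) then
                e x (decide (x ∈ u (π₀ j))) y (decide (y ∈ w j)) else 0) +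
              (if x < y ∧ (∀ z ∈ S₀ j, ¬ (x < z ∧ z < y)) then
                f x (decide (x ∈ u (π₀ j))) y (decide (y ∈ w j)) else 0))) <
        (∑ j ∈ Finset.univ.filter (fun j : Fin r => u (σ j) ≠ w j),
          ∑ x ∈ S j, ∑ y ∈ S j,
            ((if (∀ z ∈ S j, z ≤ x) ∧ (∀ z ∈ S j, y ≤ z) then
                e x (decide (x ∈ u (σ j))) y (decide (y ∈ w j)) else 0) +
              (if x < y ∧ (∀ z ∈ S j, ¬ (x < z ∧ z < y)) then
                f x (decide (x ∈ u (σ j))) y (decide (y ∈ w j)) else 0)))) →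
    ∃ (D : Fin (h + h) → Fin (h + h) → ℕ) (π₀ : Equiv.Perm (Fin r)),
      ∀ σ : Equiv.Perm (Fin r), σ ≠ π₀ →
        ∑ j, Finset.univ.inf' Finset.univ_nonempty (fun τ : Equiv.Perm (Fin h) =>
          ∑ a : Fin h, D (if a ∈ u (π₀ j) then Fin.castAdd h a else Fin.natAdd h a)
            (if τ a ∈ w j then Fin.natAdd h (τ a) else Fin.castAdd h (τ a))) <
        ∑ j, Finset.univ.inf' Finset.univ_nonempty (fun τ : Equiv.Perm (Fin h) =>
          ∑ a : Fin h, D (if a ∈ u (σ j) then Fin.castAdd h a else Fin.natAdd h a)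
            (if τ a ∈ w j then Fin.natAdd h (τ a) else Fin.castAdd h (τ a))) := by
  intro h r u w hu _ hyp
  classical
  obtain ⟨e, f, π₀, S₀, hfix, hS₀, hopt⟩ := hyp
  have hπ₀ : ∀ j, (∃ i, u i = w j) → u (π₀ j) = w j := by
    rintro j ⟨i, hi⟩
    rw [hfix i j hi]
    exact hi
  refine (UTDSymm.hasCert_iff u w).mp
    (hasCert_of_chainCertificate u w (litVal e f) π₀ hπ₀ (fun σ hσ hne => ?_))
  -- the columns charged by `π₀` and by `σ` are the non-common columns
  have hQ : ∀ ρ : Equiv.Perm (Fin r), (∀ j, (∃ i, u i = w j) → u (ρ j) = w j) →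
      univ.filter (fun j : Fin r => u (ρ j) ≠ w j) = univ.filter (fun j => ∀ i, u i ≠ w j) := by
    intro ρ hρ
    refine Finset.filter_congr (fun j _ => ⟨fun hj i hi => hj (hρ j ⟨i, hi⟩), fun hj => hj _⟩)
  have hfixσ : ∀ i j, u i = w j → σ j = i := fun i j hi => hu ((hσ j ⟨i, hi⟩).trans hi.symm)
  -- minimising position sets for `σ`
  have hmin : ∀ j, u (σ j) ≠ w j → ∃ S : Finset (Fin h),
      univ.filter (fun a => ¬ (a ∈ u (σ j) ↔ a ∈ w j)) ⊆ S ∧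
        pval e f (u (σ j)) (w j) S = sInf (chainSet (litVal e f) (u (σ j)) (w j)) :=
    fun j hj => exists_pval_eq e f _ _ (Nat.sInf_mem (chainSet_nonempty _ _ _ hj))
  set S : Fin r → Finset (Fin h) :=
    fun j => if hj : u (σ j) ≠ w j then Classical.choose (hmin j hj) else ∅ with hSdef
  have hS1 : ∀ j, u (σ j) ≠ w j → univ.filter (fun a => ¬ (a ∈ u (σ j) ↔ a ∈ w j)) ⊆ S j := by
    intro j hj
    rw [hSdef]; dsimp only; rw [dif_pos hj]
    exact (Classical.choose_spec (hmin j hj)).1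
  have hS2 : ∀ j, (hj : u (σ j) ≠ w j) →
      pval e f (u (σ j)) (w j) (S j) = sInf (chainSet (litVal e f) (u (σ j)) (w j)) := by
    intro j hj
    rw [hSdef]; dsimp only; rw [dif_pos hj]
    exact (Classical.choose_spec (hmin j hj)).2
  have key : ∑ j ∈ univ.filter (fun j : Fin r => u (π₀ j) ≠ w j), pval e f (u (π₀ j)) (w j) (S₀ j)
      < ∑ j ∈ univ.filter (fun j : Fin r => u (σ j) ≠ w j), pval e f (u (σ j)) (w j) (S j) :=
    hopt σ S hne hfixσ hS1
  rw [hQ π₀ hπ₀, hQ σ hσ] at key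
  calc ∑ j ∈ univ.filter (fun j => ∀ i, u i ≠ w j), sInf (chainSet (litVal e f) (u (π₀ j)) (w j))
      ≤ ∑ j ∈ univ.filter (fun j => ∀ i, u i ≠ w j), pval e f (u (π₀ j)) (w j) (S₀ j) := by
        refine sum_le_sum (fun j hj => Nat.sInf_le (pval_mem_chainSet e f _ _ _ ?_ ?_))
        · rw [mem_filter] at hj
          exact hj.2 (π₀ j)
        · rw [mem_filter] at hj
          exact hS₀ j (hj.2 (π₀ j))
    _ < ∑ j ∈ univ.filter (fun j => ∀ i, u i ≠ w j), pval e f (u (σ j)) (w j) (S j) := key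
    _ = ∑ j ∈ univ.filter (fun j => ∀ i, u i ≠ w j),
          sInf (chainSet (litVal e f) (u (σ j)) (w j)) := by
        refine sum_congr rfl (fun j hj => hS2 j ?_)
        rw [mem_filter] at hj
        exact hj.2 (σ j)

end Summit.ValiantsHypothesis.ValiantsHypothesis.Theorems.BarrierLever.ChainCert
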